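import Summits.CriticalPhenomena.PercolationContinuityZ3.Theorems.PercNearOneGluingNoHeavyLowerTailSunflowerNestedSheetPencilCertificate
import Summits.CriticalPhenomena.PercolationContinuityZ3.Theorems.PercNearOneGluingNoHeavyLowerTailSunflowerNestedSixPetalCertificateA
import Summits.CriticalPhenomena.PercolationContinuityZ3.Theorems.PercNearOneGluingNoHeavyLowerTailSunflowerNestedSixPetalCertificateB
import HarnessLib

/-!
# `NoHeavyLowerTail` (crux stmt-CriticalPhenomena-4575), abstract sunflower cubic at LAW level: SIX-PETAL NESTED PENCIL — the certificate IDENTITIES (part 3/4)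
# — the refinement of `…SunflowerNestedSheetPencil` keeping the `PC*` petals and the `PC` petals distinct (implies (C1) for every merging of them)

Support file (seat `prim-ineq-gen-2` gen 32; `--supports stmt-CriticalPhenomena-4575`).  Nothing is asserted about the crux; no `sorry`, no named
facts, no definitions, standard axioms.  Memo: run/shared/lean/prim/prim-ineq-gen-2/CUBIC-SIGN-LAW-GEN32.md §2b (six-petal refinement).

SETTING.  Blocks `S₁,S₂,S₃`; on block `i` a configuration lies in `G_i` (mass `g_i`), in `W_i ∖ G_i` (`u_i`) or outside `W_i` (`v_i`), `G_i ⊆ W_i`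
up-sets; everything homogeneous in `g,u,v ≥ 0`.  The SIX-petal sunflower `θ⁶(ω,z)`: for `z = 0` the `PC*(G)` labelling with petals `k⁰` ("exactly
`G_i, G_j`"), for `z = 1` the `PC(W)` labelling with petals `k¹` ("only `W_k`"); it is monotone (a lower petal point lies only below upper CORE
points).  Its law at bias `t` of `z`: bottom `b = (1−t)b* + t b_P`, lower petals `c_k = (1−t)c*_k`, upper petals `d_k = t·c_{P,k}`, core
`a = (1−t)a* + t a_P`.  THEOREM (`nestedSix_C1`): the six-petal cubic (C1) holds: `e₃(c,d) ≤ max(a,b)·(ab − e₂(c,d))` (`e_j` over all six petals).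
Since merging petals can only decrease `e₂, e₃`, this gives (C1) for `[z=0: PC*(G); z=1: PC(W)]` under EVERY identification of the six petals
into three (Theorem 4 of `…NestedSheetPencil` is the merging `k⁰ ↔ k¹`; the five `K₄` colouring classes of gen 31/32 are the face `u = 0`), and an
instance of the K-petal conjecture.  CERTIFICATE: as in the three-petal file — `β₆ = (a*−b*)·a*·(total−a_P) + P₀⁶`, `M₆ = T₆ + (a_P−b_P)·a*·(total−a_P)
− (b*−a*)·AG(m_P)`, `β₆ − M₆ + (a_P−b_P)AG(m_P) = −N₆` with `P₀⁶, T₆, N₆` coefficientwise positive (188 / 827 / 824 monomials, chunk lemmas in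
`…NestedSixPetalCertificate`), `(u₀+w₀)²Λ(t*) = u₀(u₀P₀⁶ + w₀T₆)` at the crossing, concavity, and the duality `(g,u,v,t,c,d) ↦ (v,u,g,1−t,d,c)`.
-/

namespace Summit.CriticalPhenomena.PercolationContinuityZ3.Theorems.SunflowerPartition

namespace NestedSheetPencil

section Pencil

variable {g₁ g₂ g₃ u₁ u₂ u₃ v₁ v₂ v₃ t a b c₁ c₂ c₃ d₁ d₂ d₃ as bs cs₁ cs₂ cs₃ ap bp cp₁ cp₂ cp₃ : ℝ}

/-- Cubic expansion of the six-petal `LA` along the pencil (pure algebra in the cells). [this work] -/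
theorem nested6_LA_expand
    (hb : b = (1-t)*bs + t*bp) (hc₁ : c₁ = (1-t)*cs₁) (hc₂ : c₂ = (1-t)*cs₂) (hc₃ : c₃ = (1-t)*cs₃)
    (hd₁ : d₁ = t*cp₁) (hd₂ : d₂ = t*cp₂) (hd₃ : d₃ = t*cp₃) (ha : a = (1-t)*as + t*ap) :
    a*(a*b - (c₁*c₂ + c₁*c₃ + c₁*d₁ + c₁*d₂ + c₁*d₃ + c₂*c₃ + c₂*d₁ + c₂*d₂ + c₂*d₃ + c₃*d₁ + c₃*d₂ + c₃*d₃ + d₁*d₂ + d₁*d₃ + d₂*d₃)) - (c₁*c₂*c₃ + c₁*c₂*d₁ + c₁*c₂*d₂ + c₁*c₂*d₃ + c₁*c₃*d₁ + c₁*c₃*d₂ + c₁*c₃*d₃ + c₁*d₁*d₂ + c₁*d₁*d₃ + c₁*d₂*d₃ + c₂*c₃*d₁ + c₂*c₃*d₂ + c₂*c₃*d₃ + c₂*d₁*d₂ + c₂*d₁*d₃ + c₂*d₂*d₃ + c₃*d₁*d₂ + c₃*d₁*d₃ + c₃*d₂*d₃ + d₁*d₂*d₃) =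
      (1-t)^3 * (as*(as*bs - (cs₁*cs₂+cs₁*cs₃+cs₂*cs₃)) - cs₁*cs₂*cs₃) + (1-t)^2*t * (ap*(2*as*bs - (cs₁*cs₂+cs₁*cs₃+cs₂*cs₃)) + bp*as^2 - (cp₁+cp₂+cp₃)*(as*(cs₁+cs₂+cs₃) + (cs₁*cs₂+cs₁*cs₃+cs₂*cs₃))) + (1-t)*t^2 * (as*(2*ap*bp - (cp₁*cp₂+cp₁*cp₃+cp₂*cp₃)) + bs*ap^2 - (cs₁+cs₂+cs₃)*(ap*(cp₁+cp₂+cp₃) + (cp₁*cp₂+cp₁*cp₃+cp₂*cp₃))) + t^3 * (ap*(ap*bp - (cp₁*cp₂+cp₁*cp₃+cp₂*cp₃)) - cp₁*cp₂*cp₃) := by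
  rw [ha, hb, hc₁, hc₂, hc₃, hd₁, hd₂, hd₃]; ring

/-- **(β₆)**: `β₆ = (a* − b*)·a*·(total − a_P) + P₀⁶`, `P₀⁶ ≥ 0` (sum of the `nested6_P0_chunk` pieces). [this work] -/
theorem nested6_beta_eq (hg₁ : 0 ≤ g₁) (hg₂ : 0 ≤ g₂) (hg₃ : 0 ≤ g₃) (hu₁ : 0 ≤ u₁) (hu₂ : 0 ≤ u₂) (hu₃ : 0 ≤ u₃)
    (hv₁ : 0 ≤ v₁) (hv₂ : 0 ≤ v₂) (hv₃ : 0 ≤ v₃)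
    (has : as = g₁*g₂*g₃) (hcs₁ : cs₁ = g₂*g₃*(u₁+v₁)) (hcs₂ : cs₂ = g₁*g₃*(u₂+v₂)) (hcs₃ : cs₃ = g₁*g₂*(u₃+v₃))
    (hbs : bs = (g₁+u₁+v₁)*(g₂+u₂+v₂)*(g₃+u₃+v₃) - g₁*g₂*g₃ - g₂*g₃*(u₁+v₁) - g₁*g₃*(u₂+v₂) - g₁*g₂*(u₃+v₃))
    (hbp : bp = v₁*v₂*v₃) (hcp₁ : cp₁ = (g₁+u₁)*v₂*v₃) (hcp₂ : cp₂ = (g₂+u₂)*v₁*v₃) (hcp₃ : cp₃ = (g₃+u₃)*v₁*v₂)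
    (hap : ap = (g₁+u₁+v₁)*(g₂+u₂+v₂)*(g₃+u₃+v₃) - v₁*v₂*v₃ - (g₁+u₁)*v₂*v₃ - (g₂+u₂)*v₁*v₃ - (g₃+u₃)*v₁*v₂) :
    ∃ P₀ : ℝ, 0 ≤ P₀ ∧ (ap*(2*as*bs - (cs₁*cs₂+cs₁*cs₃+cs₂*cs₃)) + bp*as^2 - (cp₁+cp₂+cp₃)*(as*(cs₁+cs₂+cs₃) + (cs₁*cs₂+cs₁*cs₃+cs₂*cs₃))) = (as - bs) * (as * ((g₁+u₁+v₁)*(g₂+u₂+v₂)*(g₃+u₃+v₃) - ap)) + P₀ := by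
  obtain ⟨r1, hr1, er1⟩ := nested6_P0_chunk1 hg₁ hg₂ hg₃ hu₁ hu₂ hu₃ hv₁ hv₂ hv₃
  obtain ⟨r2, hr2, er2⟩ := nested6_P0_chunk2 hg₁ hg₂ hg₃ hu₁ hu₂ hu₃ hv₁ hv₂ hv₃
  obtain ⟨r3, hr3, er3⟩ := nested6_P0_chunk3 hg₁ hg₂ hg₃ hu₁ hu₂ hu₃ hv₁ hv₂ hv₃
  obtain ⟨r4, hr4, er4⟩ := nested6_P0_chunk4 hg₁ hg₂ hg₃ hu₁ hu₂ hu₃ hv₁ hv₂ hv₃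
  obtain ⟨r5, hr5, er5⟩ := nested_P0_chunk5 hg₁ hg₂ hg₃ hu₁ hu₂ hu₃ hv₁ hv₂ hv₃
  refine ⟨r1 + r2 + r3 + r4 + r5, by positivity, ?_⟩
  rw [er1, er2, er3, er4, er5, has, hbs, hcs₁, hcs₂, hcs₃, hap, hbp, hcp₁, hcp₂, hcp₃]; ring

/-- **(T₆)**: `M₆ = T₆ + (a_P − b_P)·a*·(total − a_P) − (b* − a*)·AG(m_P)`, `T₆ ≥ 0` (sum of the `nested6_T_chunk` pieces). [this work] -/
theorem nested6_T_eq (hg₁ : 0 ≤ g₁) (hg₂ : 0 ≤ g₂) (hg₃ : 0 ≤ g₃) (hu₁ : 0 ≤ u₁) (hu₂ : 0 ≤ u₂) (hu₃ : 0 ≤ u₃)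
    (hv₁ : 0 ≤ v₁) (hv₂ : 0 ≤ v₂) (hv₃ : 0 ≤ v₃)
    (has : as = g₁*g₂*g₃) (hcs₁ : cs₁ = g₂*g₃*(u₁+v₁)) (hcs₂ : cs₂ = g₁*g₃*(u₂+v₂)) (hcs₃ : cs₃ = g₁*g₂*(u₃+v₃))
    (hbs : bs = (g₁+u₁+v₁)*(g₂+u₂+v₂)*(g₃+u₃+v₃) - g₁*g₂*g₃ - g₂*g₃*(u₁+v₁) - g₁*g₃*(u₂+v₂) - g₁*g₂*(u₃+v₃))
    (hbp : bp = v₁*v₂*v₃) (hcp₁ : cp₁ = (g₁+u₁)*v₂*v₃) (hcp₂ : cp₂ = (g₂+u₂)*v₁*v₃) (hcp₃ : cp₃ = (g₃+u₃)*v₁*v₂)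
    (hap : ap = (g₁+u₁+v₁)*(g₂+u₂+v₂)*(g₃+u₃+v₃) - v₁*v₂*v₃ - (g₁+u₁)*v₂*v₃ - (g₂+u₂)*v₁*v₃ - (g₃+u₃)*v₁*v₂) :
    ∃ T : ℝ, 0 ≤ T ∧ (as*(2*ap*bp - (cp₁*cp₂+cp₁*cp₃+cp₂*cp₃)) + bs*ap^2 - (cs₁+cs₂+cs₃)*(ap*(cp₁+cp₂+cp₃) + (cp₁*cp₂+cp₁*cp₃+cp₂*cp₃))) = T + (ap - bp) * (as * ((g₁+u₁+v₁)*(g₂+u₂+v₂)*(g₃+u₃+v₃) - ap)) - (bs - as) * (ap*bp - (cp₁*cp₂+cp₁*cp₃+cp₂*cp₃)) := by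
  obtain ⟨q1, hq1, eq1⟩ := nested_T_chunk1 hg₁ hg₂ hg₃ hu₁ hu₂ hu₃ hv₁ hv₂ hv₃
  obtain ⟨q2, hq2, eq2⟩ := nested_T_chunk2 hg₁ hg₂ hg₃ hu₁ hu₂ hu₃ hv₁ hv₂ hv₃
  obtain ⟨q3, hq3, eq3⟩ := nested6_T_chunk3 hg₁ hg₂ hg₃ hu₁ hu₂ hu₃ hv₁ hv₂ hv₃
  obtain ⟨q4, hq4, eq4⟩ := nested6_T_chunk4 hg₁ hg₂ hg₃ hu₁ hu₂ hu₃ hv₁ hv₂ hv₃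
  obtain ⟨q5, hq5, eq5⟩ := nested6_T_chunk5 hg₁ hg₂ hg₃ hu₁ hu₂ hu₃ hv₁ hv₂ hv₃
  obtain ⟨q6, hq6, eq6⟩ := nested6_T_chunk6 hg₁ hg₂ hg₃ hu₁ hu₂ hu₃ hv₁ hv₂ hv₃
  obtain ⟨q7, hq7, eq7⟩ := nested_T_chunk7 hg₁ hg₂ hg₃ hu₁ hu₂ hu₃ hv₁ hv₂ hv₃
  obtain ⟨q8, hq8, eq8⟩ := nested6_T_chunk8 hg₁ hg₂ hg₃ hu₁ hu₂ hu₃ hv₁ hv₂ hv₃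
  obtain ⟨q9, hq9, eq9⟩ := nested6_T_chunk9 hg₁ hg₂ hg₃ hu₁ hu₂ hu₃ hv₁ hv₂ hv₃
  obtain ⟨q10, hq10, eq10⟩ := nested6_T_chunk10 hg₁ hg₂ hg₃ hu₁ hu₂ hu₃ hv₁ hv₂ hv₃
  obtain ⟨q11, hq11, eq11⟩ := nested6_T_chunk11 hg₁ hg₂ hg₃ hu₁ hu₂ hu₃ hv₁ hv₂ hv₃
  obtain ⟨q12, hq12, eq12⟩ := nested6_T_chunk12 hg₁ hg₂ hg₃ hu₁ hu₂ hu₃ hv₁ hv₂ hv₃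
  obtain ⟨q13, hq13, eq13⟩ := nested_T_chunk13 hg₁ hg₂ hg₃ hu₁ hu₂ hu₃ hv₁ hv₂ hv₃
  obtain ⟨q14, hq14, eq14⟩ := nested6_T_chunk14 hg₁ hg₂ hg₃ hu₁ hu₂ hu₃ hv₁ hv₂ hv₃
  obtain ⟨q15, hq15, eq15⟩ := nested6_T_chunk15 hg₁ hg₂ hg₃ hu₁ hu₂ hu₃ hv₁ hv₂ hv₃
  obtain ⟨q16, hq16, eq16⟩ := nested6_T_chunk16 hg₁ hg₂ hg₃ hu₁ hu₂ hu₃ hv₁ hv₂ hv₃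
  obtain ⟨q17, hq17, eq17⟩ := nested6_T_chunk17 hg₁ hg₂ hg₃ hu₁ hu₂ hu₃ hv₁ hv₂ hv₃
  obtain ⟨q18, hq18, eq18⟩ := nested_T_chunk18 hg₁ hg₂ hg₃ hu₁ hu₂ hu₃ hv₁ hv₂ hv₃
  obtain ⟨q19, hq19, eq19⟩ := nested_T_chunk19 hg₁ hg₂ hg₃ hu₁ hu₂ hu₃ hv₁ hv₂ hv₃
  obtain ⟨q20, hq20, eq20⟩ := nested_T_chunk20 hg₁ hg₂ hg₃ hu₁ hu₂ hu₃ hv₁ hv₂ hv₃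
  obtain ⟨q21, hq21, eq21⟩ := nested_T_chunk21 hg₁ hg₂ hg₃ hu₁ hu₂ hu₃ hv₁ hv₂ hv₃
  refine ⟨q1 + q2 + q3 + q4 + q5 + q6 + q7 + q8 + q9 + q10 + q11 + q12 + q13 + q14 + q15 + q16 + q17 + q18 + q19 + q20 + q21, by positivity, ?_⟩
  rw [eq1, eq2, eq3, eq4, eq5, eq6, eq7, eq8, eq9, eq10, eq11, eq12, eq13, eq14, eq15, eq16, eq17, eq18, eq19, eq20, eq21, has, hbs, hcs₁, hcs₂, hcs₃, hap, hbp, hcp₁, hcp₂, hcp₃]; ring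

/-- **Six-petal cubic sign law on the pencil**: `β₆ − M₆ + (a_P − b_P)AG(m_P) = LA₆(m_P − m*) = −N₆ ≤ 0` (sum of the `nested6_N_chunk` pieces).
[this work] -/
theorem nested6_L3_eq (hg₁ : 0 ≤ g₁) (hg₂ : 0 ≤ g₂) (hg₃ : 0 ≤ g₃) (hu₁ : 0 ≤ u₁) (hu₂ : 0 ≤ u₂) (hu₃ : 0 ≤ u₃)
    (hv₁ : 0 ≤ v₁) (hv₂ : 0 ≤ v₂) (hv₃ : 0 ≤ v₃)
    (has : as = g₁*g₂*g₃) (hcs₁ : cs₁ = g₂*g₃*(u₁+v₁)) (hcs₂ : cs₂ = g₁*g₃*(u₂+v₂)) (hcs₃ : cs₃ = g₁*g₂*(u₃+v₃))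
    (hbs : bs = (g₁+u₁+v₁)*(g₂+u₂+v₂)*(g₃+u₃+v₃) - g₁*g₂*g₃ - g₂*g₃*(u₁+v₁) - g₁*g₃*(u₂+v₂) - g₁*g₂*(u₃+v₃))
    (hbp : bp = v₁*v₂*v₃) (hcp₁ : cp₁ = (g₁+u₁)*v₂*v₃) (hcp₂ : cp₂ = (g₂+u₂)*v₁*v₃) (hcp₃ : cp₃ = (g₃+u₃)*v₁*v₂)
    (hap : ap = (g₁+u₁+v₁)*(g₂+u₂+v₂)*(g₃+u₃+v₃) - v₁*v₂*v₃ - (g₁+u₁)*v₂*v₃ - (g₂+u₂)*v₁*v₃ - (g₃+u₃)*v₁*v₂) :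
    ∃ D : ℝ, 0 ≤ D ∧ (ap*(2*as*bs - (cs₁*cs₂+cs₁*cs₃+cs₂*cs₃)) + bp*as^2 - (cp₁+cp₂+cp₃)*(as*(cs₁+cs₂+cs₃) + (cs₁*cs₂+cs₁*cs₃+cs₂*cs₃))) - (as*(2*ap*bp - (cp₁*cp₂+cp₁*cp₃+cp₂*cp₃)) + bs*ap^2 - (cs₁+cs₂+cs₃)*(ap*(cp₁+cp₂+cp₃) + (cp₁*cp₂+cp₁*cp₃+cp₂*cp₃))) + (ap - bp) * (ap*bp - (cp₁*cp₂+cp₁*cp₃+cp₂*cp₃)) = -D := by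
  obtain ⟨s1, hs1, es1⟩ := nested6_N_chunk1 hg₁ hg₂ hg₃ hu₁ hu₂ hu₃ hv₁ hv₂ hv₃
  obtain ⟨s2, hs2, es2⟩ := nested6_N_chunk2 hg₁ hg₂ hg₃ hu₁ hu₂ hu₃ hv₁ hv₂ hv₃
  obtain ⟨s3, hs3, es3⟩ := nested6_N_chunk3 hg₁ hg₂ hg₃ hu₁ hu₂ hu₃ hv₁ hv₂ hv₃
  obtain ⟨s4, hs4, es4⟩ := nested6_N_chunk4 hg₁ hg₂ hg₃ hu₁ hu₂ hu₃ hv₁ hv₂ hv₃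
  obtain ⟨s5, hs5, es5⟩ := nested6_N_chunk5 hg₁ hg₂ hg₃ hu₁ hu₂ hu₃ hv₁ hv₂ hv₃
  obtain ⟨s6, hs6, es6⟩ := nested6_N_chunk6 hg₁ hg₂ hg₃ hu₁ hu₂ hu₃ hv₁ hv₂ hv₃
  obtain ⟨s7, hs7, es7⟩ := nested6_N_chunk7 hg₁ hg₂ hg₃ hu₁ hu₂ hu₃ hv₁ hv₂ hv₃
  obtain ⟨s8, hs8, es8⟩ := nested6_N_chunk8 hg₁ hg₂ hg₃ hu₁ hu₂ hu₃ hv₁ hv₂ hv₃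
  obtain ⟨s9, hs9, es9⟩ := nested6_N_chunk9 hg₁ hg₂ hg₃ hu₁ hu₂ hu₃ hv₁ hv₂ hv₃
  obtain ⟨s10, hs10, es10⟩ := nested6_N_chunk10 hg₁ hg₂ hg₃ hu₁ hu₂ hu₃ hv₁ hv₂ hv₃
  obtain ⟨s11, hs11, es11⟩ := nested6_N_chunk11 hg₁ hg₂ hg₃ hu₁ hu₂ hu₃ hv₁ hv₂ hv₃
  obtain ⟨s12, hs12, es12⟩ := nested6_N_chunk12 hg₁ hg₂ hg₃ hu₁ hu₂ hu₃ hv₁ hv₂ hv₃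
  obtain ⟨s13, hs13, es13⟩ := nested6_N_chunk13 hg₁ hg₂ hg₃ hu₁ hu₂ hu₃ hv₁ hv₂ hv₃
  obtain ⟨s14, hs14, es14⟩ := nested6_N_chunk14 hg₁ hg₂ hg₃ hu₁ hu₂ hu₃ hv₁ hv₂ hv₃
  obtain ⟨s15, hs15, es15⟩ := nested6_N_chunk15 hg₁ hg₂ hg₃ hu₁ hu₂ hu₃ hv₁ hv₂ hv₃
  obtain ⟨s16, hs16, es16⟩ := nested6_N_chunk16 hg₁ hg₂ hg₃ hu₁ hu₂ hu₃ hv₁ hv₂ hv₃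
  obtain ⟨s17, hs17, es17⟩ := nested6_N_chunk17 hg₁ hg₂ hg₃ hu₁ hu₂ hu₃ hv₁ hv₂ hv₃
  obtain ⟨s18, hs18, es18⟩ := nested6_N_chunk18 hg₁ hg₂ hg₃ hu₁ hu₂ hu₃ hv₁ hv₂ hv₃
  obtain ⟨s19, hs19, es19⟩ := nested6_N_chunk19 hg₁ hg₂ hg₃ hu₁ hu₂ hu₃ hv₁ hv₂ hv₃
  obtain ⟨s20, hs20, es20⟩ := nested6_N_chunk20 hg₁ hg₂ hg₃ hu₁ hu₂ hu₃ hv₁ hv₂ hv₃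
  obtain ⟨s21, hs21, es21⟩ := nested6_N_chunk21 hg₁ hg₂ hg₃ hu₁ hu₂ hu₃ hv₁ hv₂ hv₃
  refine ⟨s1 + s2 + s3 + s4 + s5 + s6 + s7 + s8 + s9 + s10 + s11 + s12 + s13 + s14 + s15 + s16 + s17 + s18 + s19 + s20 + s21, by positivity, ?_⟩
  rw [es1, es2, es3, es4, es5, es6, es7, es8, es9, es10, es11, es12, es13, es14, es15, es16, es17, es18, es19, es20, es21, has, hbs, hcs₁, hcs₂, hcs₃, hap, hbp, hcp₁, hcp₂, hcp₃]; ring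


end Pencil

end NestedSheetPencil

end Summit.CriticalPhenomena.PercolationContinuityZ3.Theorems.SunflowerPartition
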